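import Summits.NavierStokesRegularity.NavierStokesRegularity.Theorems.AxisymmetricExtremalityAxisymmetricKatoGlobalStubSeregin2020TypeIILemma22AssemblyErrPackage
import Summits.NavierStokesRegularity.NavierStokesRegularity.Theorems.AxisymmetricExtremalityAxisymmetricKatoGlobalStubSeregin2020TypeIILemma22ErrorPackage
import HarnessLib

/-!
# Seregin 2020, Theorem 2.1 via Lemma 2.2: the assembly REDUCED to the single registered Moser atom

Toward the stub `stub_seregin2020TypeII` of the crux `AxisymmetricKatoGlobal` (= the named input
`Literature.Analysis.FluidPDE.Seregin2020_axisymmetricSingularPoint_typeII`, G. Seregin, Anal. Math.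
Phys. 10 (2020) Paper 46 = arXiv:2006.04140, Thm 2.1; cell pub/ns-inputs, kits/A1.md §2′,
kits/A1-assembly-hEC.md, kits/A1-hErrPkg.lean). With seat ser-b's excision-error package
`excisionError_package` (…Lemma22ErrorPackage; N–U 2012 §3 Remark 9 for Seregin's class `𝒱`: the
energy class of the normalised pair ACROSS the axis and the parabolic-null singular set `S`) the
hypothesis `hErrPkg` of `seregin2020_typeII_of_moser_and_errPackage` (…Lemma22AssemblyErrPackage) is
discharged by a lambda — its binders are a subset of the hEC contract's. Hence:

* `seregin2020_typeII_of_smallSublevel_lowerBound` — `hL31 → Seregin2020_axisymmetricSingularPoint_typeII`,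
  where `hL31` is the registered atom `lemma22_smallSublevel_lowerBound` of
  stmt-NavierStokesRegularity-15453 VERBATIM (N–U 2012 Lemma 3.1: the Moser lower bound on small
  sublevel sets; ⇐ the registered reverse-Hölder step `lemma22_moserStep` by seat ser-c's
  `lemma22_smallSublevel_lowerBound_of_moserStep`).

So the named input (L22-A measure estimate + L22-B energy class + L22-C expansion of positivity, all
landed) is now EXACTLY ONE registered stub away. CONDITIONAL on `hL31`; no Navier–Stokes regularity
statement is proved here — a printed theorem is being re-proved as an INPUT, which makes the
conditional lines unconditional AS TYPED once it lands.

## References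

* G. Seregin, Anal. Math. Phys. 10 (2020), Paper 46 = arXiv:2006.04140, Thm 2.1, Lemma 2.2, §3.
  [Seregin2020]
* A. I. Nazarov, N. N. Uraltseva, St. Petersburg Math. J. 23 (2012) 93–115 = arXiv:1011.1888,
  Lemma 3.1, Cor 3.3, §3 (3.9), Remark 9, Lemma 4.2. [NazarovUraltseva2012]
-/

-- the problem directory repeats the summit name (D-0017); core's `dupNamespace` linter fires
set_option linter.dupNamespace false

noncomputable section

open MeasureTheory Set Function Filter Topology TopologicalSpace Metric
open scoped NNReal ENNReal InnerProductSpace RealInnerProductSpace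

namespace Summit.NavierStokesRegularity.NavierStokesRegularity.Theorems.AxisymmetricKatoGlobal.EulerScaling

open Literature.Analysis.FluidPDE Literature.Analysis.FluidPDE.Seregin2020

/-- **Seregin 2020, Theorem 2.1 from the Moser atom alone**: the named input
`Seregin2020_axisymmetricSingularPoint_typeII` follows from the registered atom
`lemma22_smallSublevel_lowerBound` (hypothesis `hL31`, verbatim), by
`seregin2020_typeII_of_moser_and_errPackage` with the error package `excisionError_package` (seat
ser-b) plugged in for `hErrPkg`. CONDITIONAL on `hL31`; no NS regularity statement is proved.
[cite: Seregin2020, Thm 2.1, Lemma 2.2; NazarovUraltseva2012, Lemma 3.1, Cor 3.3, Remark 9, Lemma 4.2] -/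
theorem seregin2020_typeII_of_smallSublevel_lowerBound
    (hL31 : ∀ (lamlo θlo θhi : ℝ) (N : ℝ≥0), 1 < lamlo → lamlo ≤ 2 → 0 < θlo → θlo ≤ θhi →
      ∃ μ₁ : ℝ, 0 < μ₁ ∧
      ∀ (Φ : ℝ → EuclideanSpace ℝ (Fin 3) → ℝ) (U : ℝ → EuclideanSpace ℝ (Fin 3) → EuclideanSpace ℝ (Fin 3))
        (S : Set (ℝ × EuclideanSpace ℝ (Fin 3))) (k R : ℝ), (0 < k ∧ 0 < R ∧ Measurable (uncurry Φ) ∧ AEStronglyMeasurable (uncurry U) volume ∧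
          IsClosed S ∧ (∀ z ∈ S, cylRadius z.2 = 0) ∧ ContinuousOn (uncurry Φ) ({z : ℝ ×
          EuclideanSpace ℝ (Fin 3) | z.1 < 0} \ S) ∧ (∀ t x, 0 ≤ Φ t x) ∧ (∀ᵐ t : ℝ, t ∈ Ioo (-R ^
          2) 0 → ContDiff ℝ 1 (Φ t)) ∧ (∫⁻ s in Ioo (-R ^ 2) 0, (∫⁻ y in ball (0 : EuclideanSpace ℝ
          (Fin 3)) (2 * R), ‖U s y‖ₑ ^ (3 : ℕ)) ^ (4 / 3 : ℝ) ≤ (N : ℝ≥0∞) * ENNReal.ofReal R ^ 2) ∧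
          (∀ (H : ℝ → ℝ), ContDiff ℝ 2 H → (∀ v, deriv H v ≤ 0) → (∀ v, 0 ≤ H v) → (∀ v, 0 ≤ deriv
          (deriv H) v) → (∀ v, deriv H v ^ 2 ≤ 2 * H v * deriv (deriv H) v) → (∀ v, k ≤ v → H v = 0)
          → ∀ (Θ : EuclideanSpace ℝ (Fin 3) → ℝ), ContDiff ℝ 1 Θ → HasCompactSupport Θ → tsupport Θ
          ⊆ ball (0 : EuclideanSpace ℝ (Fin 3)) (2 * R) → ∀ (η : ℝ → ℝ), ContDiff ℝ 1 η → (∀ s, 0 ≤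
          η s) → ∀ (t₁ t₂ : ℝ), -R ^ 2 < t₁ → t₁ ≤ t₂ → t₂ < 0 → ENNReal.ofReal (η t₂ * ∫ x, H (Φ t₂
          x) * Θ x ^ 2) + ∫⁻ z in Icc t₁ t₂ ×ˢ (univ : Set (EuclideanSpace ℝ (Fin 3))),
          ENNReal.ofReal (1 / 2 * η z.1 * (deriv (deriv H) (Φ z.1 z.2) * ‖gradient (Φ z.1) z.2‖ ^ 2
          * Θ z.2 ^ 2)) ≤ ENNReal.ofReal (η t₁ * (∫ x, H (Φ t₁ x) * Θ x ^ 2) + (4 * ∫ z in Icc t₁ t₂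
          ×ˢ (univ : Set (EuclideanSpace ℝ (Fin 3))), η z.1 * (H (Φ z.1 z.2) * ‖gradient Θ z.2‖ ^
          2)) + (∫ z in Icc t₁ t₂ ×ˢ (univ : Set (EuclideanSpace ℝ (Fin 3))), η z.1 * (H (Φ z.1 z.2)
          * inner ℝ (U z.1 z.2) (gradient (fun y => Θ y ^ 2) z.2))) + (∫ z in Icc t₁ t₂ ×ˢ (univ :
          Set (EuclideanSpace ℝ (Fin 3))), η z.1 * (2 / cylRadius z.2 * (H (Φ z.1 z.2) * fderiv ℝ
          (fun y => Θ y ^ 2) z.2 (eR z.2)))) + (∫ z in Icc t₁ t₂ ×ˢ (univ : Set (EuclideanSpace ℝ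
          (Fin 3))), |deriv η z.1| * (H (Φ z.1 z.2) * Θ z.2 ^ 2))))) →
      ∀ (lam ρ θ t₀ l : ℝ), lamlo ≤ lam → lam ≤ 2 → R / 4 ≤ ρ → lam * ρ ≤ 2 * R → θlo ≤ θ → θ ≤ θhi →
        t₀ ≤ 0 → -R ^ 2 < t₀ - θ * ρ ^ 2 → 0 < l → l ≤ k →
        volume {z : ℝ × EuclideanSpace ℝ (Fin 3) |
            z ∈ Ioo (t₀ - θ * ρ ^ 2) t₀ ×ˢ ball (0 : EuclideanSpace ℝ (Fin 3)) (lam * ρ) ∧ Φ z.1 z.2 < l}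
          ≤ ENNReal.ofReal μ₁ * volume (Ioo (t₀ - θ * ρ ^ 2) t₀ ×ˢ ball (0 : EuclideanSpace ℝ (Fin 3)) (lam * ρ)) →
        (∀ᵐ z ∂(volume.restrict (Ioo (t₀ - θ / 2 * ρ ^ 2) t₀ ×ˢ ball (0 : EuclideanSpace ℝ (Fin 3)) ρ)),
            l / 2 ≤ Φ z.1 z.2) ∧
        ((∀ᵐ x ∂(volume.restrict (ball (0 : EuclideanSpace ℝ (Fin 3)) (lam * ρ))), l ≤ Φ (t₀ - θ * ρ ^ 2) x) →
          ∀ᵐ z ∂(volume.restrict (Ioo (t₀ - θ * ρ ^ 2) t₀ ×ˢ ball (0 : EuclideanSpace ℝ (Fin 3)) ρ)),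
            l / 2 ≤ Φ z.1 z.2)) :
    Seregin2020_axisymmetricSingularPoint_typeII :=
  seregin2020_typeII_of_moser_and_errPackage hL31
    (fun _U _U' _Φ _Φ' _S _R _k _N hUc _hUs _hUg _hdiv hU3 hSc _hSax _hSP hΦc _hΦs _hΦg _hΦgg _hΦt _hΦt' _hbd _hB
        hΦ0 _hsup hR hk _hN _hkax hΦ'1 hΦ'2 hU'1 hU'2 =>
      excisionError_package hUc hU3 hSc hΦc hΦ0 hR hk hΦ'1 hΦ'2 hU'1 hU'2)

end Summit.NavierStokesRegularity.NavierStokesRegularity.Theorems.AxisymmetricKatoGlobal.EulerScaling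

end
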